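import Literature.AlgebraicGeometry.KTheory.AdaptedResolution
import Literature.AlgebraicGeometry.KTheory.CoherentEulerCharacteristic
import Literature.AlgebraicGeometry.Modules.StrictlyPerfectResolutionOfVBModel
import Mathlib.Algebra.Homology.HomologicalComplexBiprod
import Mathlib.AlgebraicGeometry.Noetherian
import HarnessLib

/-!
# Resolution independence of the class `[F] = Σ(−1)ⁱ[ℰ_i] ∈ K₀(X)` of a coherent sheaf — Hartshorne III Ex. 6.9 (b), clause 1,
# PROVED from the existence of finite locally free resolutions (Fulton B.8.3 (v): dominating resolutions)

Layer `Literature/AlgebraicGeometry/KTheory` (0 NEW named facts, no instances). Sequel to `KTheory/CoherentEulerCharacteristic` (the class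
`KZero.ofCoh F R := χ(R.P)` of a coherent sheaf computed ON A GIVEN strictly perfect resolution `R`, and the displayed fact
`Hartshorne1977_eulerChar_resolution_shortExact` whose FIRST clause is «`δ(ℱ)` is independent of the resolution chosen») and to
`KTheory/AdaptedResolution` (`exists_adaptedResolution`: under `hres : ∀ G, Coh G → Nonempty (StrictlyPerfectResolution G)`, every bounded
vector-bundle complex mapping onto `H[-m]` maps, over `H[-m]`, to a vector-bundle RESOLUTION of `H[-m]`).

* §1 `IsBoundedVBComplex.eulerChar_eq_of_quasiIso_toSingle` — under `hres` on a locally noetherian scheme: two bounded complexes of vector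
  bundles `P`, `P′` concentrated in degrees `≤ m` with quasi-isomorphisms `P ⟶ H[-m]`, `P′ ⟶ H[-m]` (`H` coherent) have the same Euler
  characteristic in `K₀(X)` — both map over `H[-m]` to the adapted resolution of `P ⊞ P′ ↠ H[-m]` (Fulton B.8.3 (v): «given any two
  resolutions there is a third which dominates them both»), by chain maps which are quasi-isomorphisms (two-out-of-three), and `χ` is a
  quasi-isomorphism invariant of bounded VB complexes (`IsBoundedVBComplex.eulerChar_eq_of_quasiIso`);
* §2 **`KZero.ofCoh_eq_of_hres`** — resolution independence: `KZero.ofCoh F R = KZero.ofCoh F R′` for any two strictly perfect resolutions of a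
  coherent `F`, from `hres` ALONE;
* §3 hence **`Hartshorne1977_exists_strictlyPerfectResolution.ofCoh_eq'`**: on a noetherian integral separated regular scheme, clause 1 of the
  displayed fact `Hartshorne1977_eulerChar_resolution_shortExact` is a THEOREM under the displayed EXISTENCE fact
  `Hartshorne1977_exists_strictlyPerfectResolution` (Hartshorne III Ex. 6.9 (a) ⇒ the first half of Ex. 6.9 (b)); and
  **`KZero.ofCoh_eq_of_vbModel`**: on a complex abelian variety it holds under [SP] `ThomasonTrobaugh_vbModel_of_boundedCoh` alone
  (`Modules/StrictlyPerfectResolutionOfVBModel.nonempty_strictlyPerfectResolution_of_coh`).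

The additivity clause of Ex. 6.9 (b) (Fulton B.8.3 (iii)–(iv), compatible resolutions of a short exact sequence) is not treated here. Typed for the
cell `pub-hodge-ring2` (the (k3) lane: `χ`/`ch` of a bounded VB complex depends only on its derived class); a research route conditional on
HC_CM, not a corollary — nothing in this file refers to it.

## References

* R. Hartshorne, *Algebraic Geometry* (1977), III Ex. 6.9 (a), (b) (p. 238–239). [Hartshorne1977]
* W. Fulton, *Intersection Theory*, 2nd ed. (1998), App. B.8.3 (v), §15.1. [Fulton1998]
* A. Borel, J.-P. Serre, *Le théorème de Riemann–Roch*, Bull. SMF 86 (1958), §4 Lemmes 11–12.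
* R. W. Thomason, T. Trobaugh, *Higher algebraic K-theory of schemes and of derived categories* (1990), Prop. 2.3.1 (d). [ThomasonTrobaugh1990]
-/

noncomputable section

universe w u

open CategoryTheory CategoryTheory.Limits AlgebraicGeometry ZeroObject HomologicalComplex

namespace Literature.AlgebraicGeometry.KTheory

open Literature.AlgebraicGeometry.Modules Literature.AlgebraicGeometry.Morphisms Literature.AlgebraicGeometry.Motives
  Literature.Algebra.Homology.AttachCell Literature.AlgebraicGeometry.KTheory.Adapted

variable {X : Scheme.{u}}

/-! ### §1 Two vector-bundle resolutions of `H[-m]` have the same Euler characteristic -/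

namespace IsBoundedVBComplex

variable {K L : CochainComplex X.Modules ℤ}

/-- The binary biproduct of two bounded complexes of vector bundles is one (`(K ⊞ L)ⁱ ≅ Kⁱ ⊞ Lⁱ`). [cite: Fulton1998, App. B.8.3 (v)] -/
theorem biprod (hK : IsBoundedVBComplex K) (hL : IsBoundedVBComplex L) : IsBoundedVBComplex (K ⊞ L) := by
  classical
  obtain ⟨s, hs⟩ := hK.exists_finset
  obtain ⟨t, ht⟩ := hL.exists_finset
  refine ⟨fun i ↦ Modules.isFiniteLocallyFree_of_iso (HomologicalComplex.biprodXIso K L i).symm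
    (KZero.isFiniteLocallyFree_biprod (hK.isFiniteLocallyFree i) (hL.isFiniteLocallyFree i)), ⟨s ∪ t, fun i hi ↦ ?_⟩⟩
  rw [Finset.mem_union, not_or] at hi
  exact (isZero_biprod_of_isZero (hs i hi.1) (ht i hi.2)).of_iso (HomologicalComplex.biprodXIso K L i)

/-- The biproduct of two complexes concentrated in degrees `≤ m` is concentrated in degrees `≤ m`. [cite: Fulton1998, App. B.8.3 (v)] -/
theorem isStrictlyLE_biprod (m : ℤ) [K.IsStrictlyLE m] [L.IsStrictlyLE m] : (K ⊞ L).IsStrictlyLE m := by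
  rw [CochainComplex.isStrictlyLE_iff]
  intro i hi
  exact (isZero_biprod_of_isZero (K.isZero_of_isStrictlyLE m i hi) (L.isZero_of_isStrictlyLE m i hi)).of_iso
    (HomologicalComplex.biprodXIso K L i)

/-- A quasi-isomorphism `ε : P ⟶ H[-m]` from a complex with `Pᵐ⁺¹ = 0` is an epimorphism in degree `m`. [cite: Fulton1998, App. B.8.3 (v)] -/
theorem epi_f_of_quasiIso_toSingle {P : CochainComplex X.Modules ℤ} {m : ℤ} [P.IsStrictlyLE m] {H : X.Modules}
    (ε : P ⟶ (HomologicalComplex.single X.Modules (ComplexShape.up ℤ) m).obj H) (hε : QuasiIso ε) : Epi (ε.f m) := by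
  have h := ((quasiIsoAt_toSingle_iff P m (P.isZero_of_isStrictlyLE m (m + 1) (by omega)) H ε).1 (hε.quasiIsoAt m)).2
  have : ε.f m = (ε.f m ≫ (HomologicalComplex.singleObjXSelf (ComplexShape.up ℤ) m H).hom) ≫
      (HomologicalComplex.singleObjXSelf (ComplexShape.up ℤ) m H).inv := by simp
  rw [this]
  exact epi_comp _ _

/-- **Two bounded vector-bundle complexes resolving the same `H[-m]` have the same Euler characteristic in `K₀(X)`** (under `hres`, `X`
locally noetherian, `H` coherent): both map, over `H[-m]` and by quasi-isomorphisms, to the adapted resolution of `P ⊞ P′ ↠ H[-m]` — Fulton's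
«given any two resolutions of `ℱ`, there is a third which dominates them both». [cite: Fulton1998, App. B.8.3 (v)]
[cite: Hartshorne1977, III Ex. 6.9 (b) (p. 239)] -/
theorem eulerChar_eq_of_quasiIso_toSingle [IsLocallyNoetherian X]
    (hres : ∀ G : X.Modules, Coh G → Nonempty (StrictlyPerfectResolution G)) {m : ℤ} {H : X.Modules} (hH : Coh H)
    {P P' : CochainComplex X.Modules ℤ} (hP : IsBoundedVBComplex P) (hP' : IsBoundedVBComplex P') [P.IsStrictlyLE m] [P'.IsStrictlyLE m]
    (ε : P ⟶ (HomologicalComplex.single X.Modules (ComplexShape.up ℤ) m).obj H)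
    (ε' : P' ⟶ (HomologicalComplex.single X.Modules (ComplexShape.up ℤ) m).obj H) (hε : QuasiIso ε) (hε' : QuasiIso ε') :
    eulerChar P hP.isFiniteLocallyFree = eulerChar P' hP'.isFiniteLocallyFree := by
  haveI := hε
  haveI := hε'
  haveI := isStrictlyLE_biprod (K := P) (L := P') m
  -- `P ⊞ P' ↠ H[-m]` in degree `m`
  haveI : Epi ((biprod.desc ε ε').f m) := by
    haveI := epi_f_of_quasiIso_toSingle ε hε
    haveI : Epi ((biprod.inl : P ⟶ P ⊞ P').f m ≫ (biprod.desc ε ε').f m) := by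
      rw [← HomologicalComplex.comp_f, biprod.inl_desc]; infer_instance
    exact epi_of_epi ((biprod.inl : P ⟶ P ⊞ P').f m) _
  obtain ⟨R, j, δ, hR, _, hjδ, hδ⟩ := exists_adaptedResolution hres (hP.biprod hP') hH (biprod.desc ε ε') inferInstance
  -- both inclusions followed by `j` are quasi-isomorphisms (two-out-of-three over `H[-m]`)
  have h₁ : (biprod.inl ≫ j) ≫ δ = ε := by rw [Category.assoc, hjδ, biprod.inl_desc]
  have h₂ : (biprod.inr ≫ j) ≫ δ = ε' := by rw [Category.assoc, hjδ, biprod.inr_desc]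
  haveI : QuasiIso (biprod.inl ≫ j) := by
    haveI : QuasiIso ((biprod.inl ≫ j) ≫ δ) := by rw [h₁]; infer_instance
    exact quasiIso_of_comp_right _ δ
  haveI : QuasiIso (biprod.inr ≫ j) := by
    haveI : QuasiIso ((biprod.inr ≫ j) ≫ δ) := by rw [h₂]; infer_instance
    exact quasiIso_of_comp_right _ δ
  rw [hP.eulerChar_eq_of_quasiIso hR (biprod.inl ≫ j), hP'.eulerChar_eq_of_quasiIso hR (biprod.inr ≫ j)]

end IsBoundedVBComplex

/-! ### §2 Resolution independence of `KZero.ofCoh` -/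

/-- **Hartshorne III Ex. 6.9 (b), clause 1 — «`δ(ℱ) = Σ(−1)ⁱ γ(ℰ_i)` is independent of the resolution chosen» — PROVED from the existence of
finite locally free resolutions** (`hres`, a displayed hypothesis) on a locally noetherian scheme: `KZero.ofCoh F R = KZero.ofCoh F R′` for any
two strictly perfect resolutions of a coherent `F`. [cite: Hartshorne1977, III Ex. 6.9 (b) (p. 239)] [cite: Fulton1998, App. B.8.3 (v)] -/
theorem KZero.ofCoh_eq_of_hres [IsLocallyNoetherian X]
    (hres : ∀ G : X.Modules, Coh G → Nonempty (StrictlyPerfectResolution G)) {F : X.Modules} (hF : Coh F)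
    (R R' : StrictlyPerfectResolution F) : KZero.ofCoh F R = KZero.ofCoh F R' :=
  IsBoundedVBComplex.eulerChar_eq_of_quasiIso_toSingle hres (m := 0) hF R.isBoundedVB R'.isBoundedVB
    (R.ε : R.P ⟶ (HomologicalComplex.single X.Modules (ComplexShape.up ℤ) 0).obj F)
    (R'.ε : R'.P ⟶ (HomologicalComplex.single X.Modules (ComplexShape.up ℤ) 0).obj F) R.quasiIso R'.quasiIso

/-- Under `hres`, the class of a vector bundle `E` on ANY of its resolutions is `KZero.of E`. [cite: Hartshorne1977, III Ex. 6.9 (b) (p. 239)] -/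
theorem KZero.ofCoh_eq_of_of_hres [IsLocallyNoetherian X]
    (hres : ∀ G : X.Modules, Coh G → Nonempty (StrictlyPerfectResolution G)) {E : X.Modules} (hE : IsFiniteLocallyFree E)
    (R : StrictlyPerfectResolution E) : KZero.ofCoh E R = KZero.of E hE := by
  rw [KZero.ofCoh_eq_of_hres hres (coh_of_isFiniteLocallyFree hE) R (StrictlyPerfectResolution.ofFiniteLocallyFree hE),
    KZero.ofCoh_ofFiniteLocallyFree]

/-! ### §3 Under the displayed existence facts -/

/-- **On a noetherian integral separated regular scheme, resolution independence follows from Hartshorne III Ex. 6.9 (a)** (the displayed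
EXISTENCE fact `Hartshorne1977_exists_strictlyPerfectResolution`): clause 1 of `Hartshorne1977_eulerChar_resolution_shortExact` is a theorem under
it. [cite: Hartshorne1977, III Ex. 6.9 (a)–(b) (p. 238–239)] -/
theorem _root_.Literature.AlgebraicGeometry.Modules.Hartshorne1977_exists_strictlyPerfectResolution.ofCoh_eq'
    (h : Hartshorne1977_exists_strictlyPerfectResolution.{u}) [IsNoetherian X] [IsIntegral X] [X.IsSeparated]
    (hX : Resolution.Scheme.IsRegular X) {F : X.Modules} (hF : Coh F) (R R' : StrictlyPerfectResolution F) :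
    KZero.ofCoh F R = KZero.ofCoh F R' :=
  KZero.ofCoh_eq_of_hres (fun G hG ↦ h X hX G hG) hF R R'

/-- **On a complex abelian variety, resolution independence follows from [SP]** `ThomasonTrobaugh_vbModel_of_boundedCoh` (through
`nonempty_strictlyPerfectResolution_of_coh`): `KZero.ofCoh F R = KZero.ofCoh F R′` for every coherent `F` and any two resolutions.
[cite: ThomasonTrobaugh1990, Prop. 2.3.1 (d)] [cite: Hartshorne1977, III Ex. 6.9 (b) (p. 239)] -/
theorem KZero.ofCoh_eq_of_vbModel (hSP : ThomasonTrobaugh_vbModel_of_boundedCoh.{w}) (B : AbelianVariety ℂ)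
    [HasDerivedCategory.{w} B.X.left.Modules] {F : B.X.left.Modules} (hF : Coh F) (R R' : StrictlyPerfectResolution F) :
    KZero.ofCoh F R = KZero.ofCoh F R' := by
  haveI : IsLocallyNoetherian B.X.left := LocallyOfFiniteType.isLocallyNoetherian B.X.hom
  exact KZero.ofCoh_eq_of_hres (fun G hG ↦ nonempty_strictlyPerfectResolution_of_coh B hSP hG) hF R R'

end Literature.AlgebraicGeometry.KTheory

end
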